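import Summits.QuantumFields.YangMills.Theorems.SourcedPressureJensenSourcedPressureIncrementGaussFirstCumulant
import Summits.QuantumFields.YangMills.Theorems.SourcedPressureJensenSourcedPressureIncrementCurvatureDecay
import HarnessLib

/-!
# Crux `RunningCouplingCeiling` (repaired: stmt-QuantumFields-24275), line «pointwise-log-ceiling-r»: the Gaussian
# (lattice Maxwell curvature) model of the kernel clauses — the scale-free clause is exact, the log clause FAILS

Sanity helper (`--supports stmt-QuantumFields-24275 --as helper`, lead's WAKE target 3) by the width prover
`ym-line-frs-p3` (g2) of route `ForcedResponseSkewness` (lead `ym-line-frs-p1`).  The registered physics stub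
`stub_pointwise : PointwiseSigR` asks, for the torus covariance `K = torusCov β L` of the action densities at unit `t = a(β)`,
the three clauses of `KernelBounds`: bounded (`C₂`), scale-free (`d⁸|K| ≤ C₁`, `d ≥ n₀`) and the running-coupling decay
`d⁸|K| ≤ C₀ / log²(1/(t d))` for `n₀ ≤ d`, `t d ≤ ½`.  Here we evaluate the analogous axis kernel in the tree's FREE model —
the curvature Gaussian field `γ = curvatureGaussianField 4 D` (`D` colours; the `β → ∞` Gaussian of the plaquette field
strength, `Literature/…/CurvatureGaussianField`), with the quadratic composite
`A_x = (λ/2)|Y(p₁₂ x)|² − (λ/2)·D·C(0)` of the record-label lines (`SourcedPressureJensen`, `EntropyBudgetEquipartition`):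

* by Isserlis (`SourcedPressureIncrement.Birth.gauss_firstCumulant`, landed) the free kernel along the time axis is EXACTLY
  `K_γ(x, x + n e₀) = E_γ[A_x A_{x+ne₀}] = (λ²D/2)·c_n²`, `c_n = curvaturePlaquetteCorr 4 n`;
* the tree holds BOTH the ceiling `|c_n| ≤ C|n|⁻⁴` (`SourcedPressureIncrement.Birth.abs_curvaturePlaquetteCorr_le`, Lawler
  (1.37)) and the floor `κ/n⁴ ≤ |c_n|` for `n ≥ n₁` — the latter is route `WeakCouplingRates`' CLOSED item
  `CurvatureCorrPowerFloor` (`WeakCouplingRates.curvatureCorrPowerFloor_proof`), taken below as an explicit HYPOTHESIS `hfloor`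
  (verbatim its body) so that this file stays outside that route file's import cone;
* so `pow_eight_mul_sq_corr_le` / `le_pow_eight_mul_sq_corr`: `κ² ≤ n⁸ c_n² ≤ C²`, and for the free kernel:
  **`gaussModel_scaleFree`** — `n⁸ |K_γ(x, x+ne₀)| ≤ C₁` for all `n ≥ 1` (the scale-free clause is realised by the free
  field, with NO logarithmic gain), **`gaussModel_floor`** — `n⁸ |K_γ| ≥ (λ²D/2)κ² > 0` for `n ≥ n₁` (`D ≥ 1`, `λ ≠ 0`), and
  **`gaussModel_not_logDecay`** — consequently (given `hfloor`) there are NO `C₀`, `n₀`, `t₀ > 0` with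
  `n⁸|K_γ(x, x+ne₀)| ≤ C₀/log²(1/(t n))` for all `0 < t ≤ t₀`, `n ≥ n₀`, `t n ≤ ½`: at `n = max n₀ n₁` the left side is
  `≥ (λ²D/2)κ²` while the right side `→ 0` as the unit `t → 0`.

Reading: the running-coupling clause of `stub_pointwise` is false for the lattice Maxwell curvature field (no asymptotic
freedom in the free theory: `d⁸ Cov` tends to a positive constant instead of decaying like `1/log²`), so it cannot be obtained
from any Gaussian-domination / free-field comparison — it is the genuinely non-abelian content of the crux (route card's
LogCeilingAtPhysicalScale; barrier entry PerturbativeInvisibility places the log ceiling outside the Gaussian class).  The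
bounded and scale-free clauses, by contrast, hold already in the free model.

Honest label: a sanity computation in the FREE model; nothing here is a statement about lattice Yang–Mills, no stub of 24275
is closed, and nothing bears on the Yang–Mills mass gap, which is NOT proved by any of this.  Conditional rung line (leaf R2a
`BalabanLadder.NT`).  Isserlis (1918); Lawler, *Intersections of random walks* (1991) Thm 1.5.5. [folklore]
-/

set_option autoImplicit false

noncomputable section

namespace Summit.QuantumFields.YangMills.Cruxes.RunningCouplingCeiling.Pointwise.GaussModel

open MeasureTheory
open Literature.MathematicalPhysics.QuantumFieldTheory Literature.MathematicalPhysics.QuantumLattice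
open Literature.Probability.LatticeModels
open Summit.QuantumFields.YangMills.Cruxes.SourcedPressureIncrement.Birth (gauss_firstCumulant abs_curvaturePlaquetteCorr_le)

/-! ### The axis plaquette numbers: `κ² ≤ n⁸ c_n² ≤ C` -/

/-- **Ceiling** `n⁸ c_n² ≤ C²` for `n ≥ 1`, from the tree's `|c_n| ≤ C|n|⁻⁴` (`abs_curvaturePlaquetteCorr_le`,
Lawler (1.37) through the transverse second difference of the Green function). [folklore] -/
theorem pow_eight_mul_sq_corr_le : ∃ C₁ : ℝ, 0 ≤ C₁ ∧ ∀ n : ℕ, 1 ≤ n →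
    (n : ℝ) ^ 8 * (curvaturePlaquetteCorr (d := 4) (by norm_num) (n : ℤ)) ^ 2 ≤ C₁ := by
  obtain ⟨C, hC0, hC⟩ := abs_curvaturePlaquetteCorr_le (d := 4) (by norm_num)
  refine ⟨C ^ 2, by positivity, fun n hn => ?_⟩
  have hn0 : (0 : ℝ) < n := by exact_mod_cast hn
  have hn4 : (0 : ℝ) < (n : ℝ) ^ 4 := by positivity
  have hnz : (n : ℤ) ≠ 0 := by exact_mod_cast (show n ≠ 0 by omega)
  set c : ℝ := curvaturePlaquetteCorr (d := 4) (by norm_num) (n : ℤ) with hc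
  have h := hC (n : ℤ) hnz
  rw [← hc] at h
  have hrpow : (|((n : ℤ) : ℝ)|) ^ (-((4 : ℕ) : ℝ)) = ((n : ℝ) ^ 4)⁻¹ := by
    rw [Int.cast_natCast, abs_of_nonneg hn0.le, Real.rpow_neg hn0.le, Real.rpow_natCast]
  rw [hrpow, ← div_eq_mul_inv] at h
  -- `|c| n⁴ ≤ C`
  have h4 : |c| * (n : ℝ) ^ 4 ≤ C := (le_div_iff₀ hn4).1 h
  calc (n : ℝ) ^ 8 * c ^ 2 = (|c| * (n : ℝ) ^ 4) ^ 2 := by rw [mul_pow, sq_abs]; ring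
    _ ≤ C ^ 2 := pow_le_pow_left₀ (by positivity) h4 2

/-- **Floor** `κ² ≤ n⁸ c_n²` for `n ≥ n₁` (`n₁ ≥ 1`), from the axis floor `κ/n⁴ ≤ |c_n|` — hypothesis `hfloor`, verbatim
the body of route `WeakCouplingRates`' closed item `CurvatureCorrPowerFloor` (proved in tree:
`WeakCouplingRates.curvatureCorrPowerFloor_proof`). [folklore] -/
theorem le_pow_eight_mul_sq_corr
    (hfloor : ∃ κ : ℝ, 0 < κ ∧ ∃ n₀ : ℕ, ∀ n : ℕ, n₀ ≤ n →
      κ / (n : ℝ) ^ 4 ≤ |curvaturePlaquetteCorr (d := 4) (by norm_num) (n : ℤ)|) :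
    ∃ c : ℝ, 0 < c ∧ ∃ n₁ : ℕ, 1 ≤ n₁ ∧ ∀ n : ℕ, n₁ ≤ n →
      c ≤ (n : ℝ) ^ 8 * (curvaturePlaquetteCorr (d := 4) (by norm_num) (n : ℤ)) ^ 2 := by
  obtain ⟨κ, hκ, n₀, h⟩ := hfloor
  refine ⟨κ ^ 2, by positivity, max n₀ 1, le_max_right _ _, fun n hn => ?_⟩
  have hn1 : 1 ≤ n := le_trans (le_max_right _ _) hn
  have hn0 : (0 : ℝ) < n := by exact_mod_cast hn1
  have hn4 : (0 : ℝ) < (n : ℝ) ^ 4 := by positivity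
  set c : ℝ := curvaturePlaquetteCorr (d := 4) (by norm_num) (n : ℤ) with hc
  have h1 := h n (le_trans (le_max_left _ _) hn)
  rw [← hc] at h1
  have h2 : κ ≤ |c| * (n : ℝ) ^ 4 := (div_le_iff₀ hn4).1 h1
  calc κ ^ 2 ≤ (|c| * (n : ℝ) ^ 4) ^ 2 := pow_le_pow_left₀ hκ.le h2 2
    _ = (n : ℝ) ^ 8 * c ^ 2 := by rw [mul_pow, sq_abs]; ring

/-! ### The free kernel `K_γ(x, x + n e₀) = E_γ[A_x A_{x+ne₀}] = (λ²D/2) c_n²` -/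

/-- **`gaussModel_scaleFree` — the scale-free clause holds in the free model, with no logarithmic gain.**  For the
curvature Gaussian field with `D` colours and `A_x = (λ/2)|Y(p₁₂ x)|² − (λ/2)·D·C(0)`:
`n⁸ · |E_γ[A_x A_{x+ne₀}]| ≤ C₁` for every `x ∈ ℤ⁴` and `n ≥ 1` (`C₁ = |λ²D/2|·((6|a|+K)/3)²`). [folklore] -/
theorem gaussModel_scaleFree (D : ℕ) (lam : ℝ) : ∃ C₁ : ℝ, 0 ≤ C₁ ∧ ∀ (x : Site 4) (n : ℕ), 1 ≤ n →
    (n : ℝ) ^ 8 * |∫ Y, (lam / 2 * (∑ a : Fin D, (Y (plaquette12 (d := 4) (by norm_num) x) a) ^ 2) -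
            lam / 2 * D * curvaturePlaquetteCorr (d := 4) (by norm_num) 0) *
          (lam / 2 * (∑ a : Fin D, (Y (plaquette12 (d := 4) (by norm_num) (x + Pi.single (0 : Fin 4) (n : ℤ))) a) ^ 2) -
            lam / 2 * D * curvaturePlaquetteCorr (d := 4) (by norm_num) 0)
        ∂curvatureGaussianField (d := 4) D| ≤ C₁ := by
  obtain ⟨C, hC0, hC⟩ := pow_eight_mul_sq_corr_le
  refine ⟨|lam ^ 2 * D / 2| * C, by positivity, fun x n hn => ?_⟩
  rw [gauss_firstCumulant D lam n x, abs_mul,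
    abs_of_nonneg (sq_nonneg (curvaturePlaquetteCorr (d := 4) (by norm_num) (n : ℤ)))]
  calc (n : ℝ) ^ 8 * (|lam ^ 2 * D / 2| * (curvaturePlaquetteCorr (d := 4) (by norm_num) (n : ℤ)) ^ 2)
      = |lam ^ 2 * D / 2| * ((n : ℝ) ^ 8 * (curvaturePlaquetteCorr (d := 4) (by norm_num) (n : ℤ)) ^ 2) := by ring
    _ ≤ |lam ^ 2 * D / 2| * C := mul_le_mul_of_nonneg_left (hC n hn) (abs_nonneg _)

/-- **`gaussModel_floor` — the free kernel does NOT decay faster than `n⁻⁸`.**  For `D ≥ 1` colours and `λ ≠ 0` there are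
`c > 0` and `n₁ ≥ 1` with `c ≤ n⁸ · |E_γ[A_x A_{x+ne₀}]|` for every `x ∈ ℤ⁴` and `n ≥ n₁` (`c = (λ²D/2)κ²`), given the axis
floor `hfloor` (= `WeakCouplingRates.CurvatureCorrPowerFloor`, proved in tree). [folklore] -/
theorem gaussModel_floor (D : ℕ) (hD : 1 ≤ D) (lam : ℝ) (hlam : lam ≠ 0)
    (hfloor : ∃ κ : ℝ, 0 < κ ∧ ∃ n₀ : ℕ, ∀ n : ℕ, n₀ ≤ n →
      κ / (n : ℝ) ^ 4 ≤ |curvaturePlaquetteCorr (d := 4) (by norm_num) (n : ℤ)|) :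
    ∃ c : ℝ, 0 < c ∧ ∃ n₁ : ℕ, 1 ≤ n₁ ∧ ∀ (x : Site 4) (n : ℕ), n₁ ≤ n →
      c ≤ (n : ℝ) ^ 8 * |∫ Y, (lam / 2 * (∑ a : Fin D, (Y (plaquette12 (d := 4) (by norm_num) x) a) ^ 2) -
            lam / 2 * D * curvaturePlaquetteCorr (d := 4) (by norm_num) 0) *
          (lam / 2 * (∑ a : Fin D, (Y (plaquette12 (d := 4) (by norm_num) (x + Pi.single (0 : Fin 4) (n : ℤ))) a) ^ 2) -
            lam / 2 * D * curvaturePlaquetteCorr (d := 4) (by norm_num) 0)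
        ∂curvatureGaussianField (d := 4) D| := by
  obtain ⟨c, hc, n₁, hn₁, h⟩ := le_pow_eight_mul_sq_corr hfloor
  have hD0 : (0 : ℝ) < D := by exact_mod_cast hD
  have hl : 0 < lam ^ 2 := by positivity
  have hpos : 0 < lam ^ 2 * D / 2 := by positivity
  refine ⟨lam ^ 2 * D / 2 * c, by positivity, n₁, hn₁, fun x n hn => ?_⟩
  rw [gauss_firstCumulant D lam n x, abs_of_nonneg (by positivity)]
  calc lam ^ 2 * D / 2 * c ≤ lam ^ 2 * D / 2 * ((n : ℝ) ^ 8 * (curvaturePlaquetteCorr (d := 4) (by norm_num) (n : ℤ)) ^ 2) :=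
        mul_le_mul_of_nonneg_left (h n hn) hpos.le
    _ = (n : ℝ) ^ 8 * (lam ^ 2 * D / 2 * (curvaturePlaquetteCorr (d := 4) (by norm_num) (n : ℤ)) ^ 2) := by ring

/-- **`gaussModel_not_logDecay` — the running-coupling clause FAILS in the free model.**  For `D ≥ 1` colours, `λ ≠ 0` and
any base site `x`: there are NO constants `C₀`, `n₀` and unit threshold `t₀ > 0` such that
`n⁸ · |E_γ[A_x A_{x+ne₀}]| ≤ C₀ / log²(1/(t n))` for all units `0 < t ≤ t₀` and all `n ≥ n₀` with `t n ≤ ½` (the shape of the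
`C₀` clause of `KernelBounds` along the axis, eventually in the unit as in `PointwiseSigR`): at `n = max n₀ n₁` the left side
is `≥ (λ²D/2)κ² > 0` uniformly in `t`, while the right side tends to `0` as `t → 0`.  Hypothesis `hfloor` = the axis floor
`WeakCouplingRates.CurvatureCorrPowerFloor` (proved in tree: `curvatureCorrPowerFloor_proof`). [folklore] -/
theorem gaussModel_not_logDecay (D : ℕ) (hD : 1 ≤ D) (lam : ℝ) (hlam : lam ≠ 0)
    (hfloor : ∃ κ : ℝ, 0 < κ ∧ ∃ n₀ : ℕ, ∀ n : ℕ, n₀ ≤ n →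
      κ / (n : ℝ) ^ 4 ≤ |curvaturePlaquetteCorr (d := 4) (by norm_num) (n : ℤ)|) (x : Site 4) :
    ¬ ∃ (C₀ : ℝ) (n₀ : ℕ) (t₀ : ℝ), 0 < t₀ ∧ ∀ t : ℝ, 0 < t → t ≤ t₀ → ∀ n : ℕ, n₀ ≤ n → t * n ≤ 1 / 2 →
      (n : ℝ) ^ 8 * |∫ Y, (lam / 2 * (∑ a : Fin D, (Y (plaquette12 (d := 4) (by norm_num) x) a) ^ 2) -
            lam / 2 * D * curvaturePlaquetteCorr (d := 4) (by norm_num) 0) *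
          (lam / 2 * (∑ a : Fin D, (Y (plaquette12 (d := 4) (by norm_num) (x + Pi.single (0 : Fin 4) (n : ℤ))) a) ^ 2) -
            lam / 2 * D * curvaturePlaquetteCorr (d := 4) (by norm_num) 0)
        ∂curvatureGaussianField (d := 4) D| ≤ C₀ / Real.log (1 / (t * n)) ^ 2 := by
  rintro ⟨C₀, n₀, t₀, ht₀, H⟩
  obtain ⟨c, hc, n₁, hn₁, hfl⟩ := gaussModel_floor D hD lam hlam hfloor
  -- the site `n = max n₀ n₁` and a unit `t` so small that `log(1/(t n)) ≥ s + 1`, `s = √(|C₀|/c)`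
  have hn1 : 1 ≤ max n₀ n₁ := le_trans hn₁ (le_max_right _ _)
  have hnpos : (0 : ℝ) < ((max n₀ n₁ : ℕ) : ℝ) := by exact_mod_cast hn1
  set s : ℝ := Real.sqrt (|C₀| / c) with hs_def
  have hs0 : 0 ≤ s := Real.sqrt_nonneg _
  have hCs : |C₀| = c * s ^ 2 := by
    rw [hs_def, Real.sq_sqrt (by positivity)]
    field_simp
  set t : ℝ := min t₀ (Real.exp (-(s + 1)) / (2 * ((max n₀ n₁ : ℕ) : ℝ))) with ht_def
  have htpos : 0 < t := lt_min ht₀ (by positivity)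
  have ht₀' : t ≤ t₀ := min_le_left _ _
  have htn : t * ((max n₀ n₁ : ℕ) : ℝ) ≤ Real.exp (-(s + 1)) / 2 := by
    have hle : t ≤ Real.exp (-(s + 1)) / (2 * ((max n₀ n₁ : ℕ) : ℝ)) := min_le_right _ _
    calc t * ((max n₀ n₁ : ℕ) : ℝ) ≤ Real.exp (-(s + 1)) / (2 * ((max n₀ n₁ : ℕ) : ℝ)) * ((max n₀ n₁ : ℕ) : ℝ) := by
          gcongr
      _ = Real.exp (-(s + 1)) / 2 := by
          field_simp
  have hexp1 : Real.exp (-(s + 1)) ≤ 1 := by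
    rw [Real.exp_le_one_iff]
    linarith
  have hhalf : t * ((max n₀ n₁ : ℕ) : ℝ) ≤ 1 / 2 := by linarith
  have htnpos : 0 < t * ((max n₀ n₁ : ℕ) : ℝ) := by positivity
  -- the two inequalities at `n = max n₀ n₁`
  have hmain := H t htpos ht₀' (max n₀ n₁) (le_max_left _ _) hhalf
  have hV := hfl x (max n₀ n₁) (le_max_right _ _)
  set V : ℝ := ((max n₀ n₁ : ℕ) : ℝ) ^ 8 *
      |∫ Y, (lam / 2 * (∑ a : Fin D, (Y (plaquette12 (d := 4) (by norm_num) x) a) ^ 2) -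
            lam / 2 * D * curvaturePlaquetteCorr (d := 4) (by norm_num) 0) *
          (lam / 2 * (∑ a : Fin D, (Y (plaquette12 (d := 4) (by norm_num)
              (x + Pi.single (0 : Fin 4) ((max n₀ n₁ : ℕ) : ℤ))) a) ^ 2) -
            lam / 2 * D * curvaturePlaquetteCorr (d := 4) (by norm_num) 0)
        ∂curvatureGaussianField (d := 4) D| with hV_def
  set ℓ : ℝ := Real.log (1 / (t * ((max n₀ n₁ : ℕ) : ℝ))) with hℓ_def
  -- `ℓ ≥ s + 1`
  have hlog : s + 1 ≤ ℓ := by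
    rw [hℓ_def, Real.le_log_iff_exp_le (by positivity), le_div_iff₀ htnpos]
    calc Real.exp (s + 1) * (t * ((max n₀ n₁ : ℕ) : ℝ)) ≤ Real.exp (s + 1) * (Real.exp (-(s + 1)) / 2) := by
          gcongr
      _ = 1 / 2 := by
          rw [Real.exp_neg]
          field_simp
      _ ≤ 1 := by norm_num
  have hℓpos : 0 < ℓ := by linarith
  have hℓ2 : 0 < ℓ ^ 2 := by positivity
  -- `|C₀| = c s² < c ℓ² ≤ V ℓ²`, but `V ℓ² ≤ C₀`
  have hss : s ^ 2 < ℓ ^ 2 := by nlinarith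
  have h1 : c * s ^ 2 < c * ℓ ^ 2 := mul_lt_mul_of_pos_left hss hc
  have h2 : c * ℓ ^ 2 ≤ V * ℓ ^ 2 := mul_le_mul_of_nonneg_right hV hℓ2.le
  have h3 : V * ℓ ^ 2 ≤ C₀ := (le_div_iff₀ hℓ2).1 hmain
  have h4 : C₀ ≤ |C₀| := le_abs_self C₀
  linarith

end Summit.QuantumFields.YangMills.Cruxes.RunningCouplingCeiling.Pointwise.GaussModel

end
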